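import Literature.AnabelianGeometry.SemiGraphs.PSCTwoComponentPointedIncidence
import Literature.AnabelianGeometry.SemiGraphs.PSCEdgeLikeIncidenceCriteriaConj
import Literature.AnabelianGeometry.SemiGraphs.PSCSeparatingCoveringsLevelEdges
import Literature.GroupTheory.CombinatorialGroupTheory.PuncturedSurfaceGroupTwoNodeCycleBasesAny
import HarnessLib

/-!
# [CombGC] Prop. 1.5 (i) (incidence of edge-like subgroups) at the TWO-NODE-CYCLE shape (row F-0440)

Mochizuki, *A combinatorial version of the Grothendieck conjecture*, Tohoku Math. J. **59** (2007)
[CombGC], Prop. 1.5 (i) p. 12 [cite: MochizukiCombGC2007, Prop 1.5(i) p.12]: a cuspidal edge-like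
subgroup lies in exactly one verticial subgroup, a nodal one in exactly two.  PROOF-ONLY file
(abc-iut-f-164 gen 5, row «TWO-NODE-CYCLE·PROP15», the part with ≥ 2 cusps on each component): the data
of two-node-cycle shape (`PSCSeparatingCoveringsTwoNodeCycle.lean`) — the first dual graph with a CYCLE,
where no choice of representatives trivialises all branch conjugators (`Π_{n₁} = cl⟨ι b_m⟩ ≤ Π_{v₁}` and
`≤ ι(a_m)⁻¹ Π_{v₀} ι(a_m)`), whence the conjugated criterion `edgeLikeIncidence_of_conj`.  Ingredients:
free-factor malnormality (`mem_freeFactor_of_inf_conj_ne_bot`) of `Π_{v₀} = cl⟨bA(S_A)⟩`,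
`Π_{v₁} = cl⟨bl(S_B)⟩`; node/cusp disjointness by common bases (`b₀`, `bl`, the `δ`-bases
`exists_freeGroupBasis_cycleNode₂_values / _zero`); far-cusp disjointness by the bases eliminating ANOTHER
cusp of the same component (`PuncturedSurfaceGroupCuspBasesAny`, `…TwoNodeCycleBasesAny`; this is where
`2 ≤ s` and `s + 1 ≤ r'` enter — lone cusps would need the Heisenberg route); distinctness of the two
verticial overgroups of a node by the witnesses `a_0` resp. `b_{m+1}` and `freeFactor_inf_eq`.

* `edgeLikeIncidence_of_twoNodeCycle` — **F-0440 / Prop. 1.5 (i) at every two-node-cycle datum with at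
  least two cusps on each component** (`m ≥ 1`, `g - m - 1 ≥ 1`, `2 ≤ s ≤ r - 2`).
0 definitions; nothing here takes a side on [IUTchIII] Cor. 3.12.
-/

noncomputable section

namespace Literature.AnabelianGeometry.SemiGraphs

namespace PSCDatum

open scoped Pointwise
open Literature.GroupTheory.CombinatorialGroupTheory
open Literature.GroupTheory.CombinatorialGroupTheory.PuncturedSurfaceGroup (a b c cuspInertia
  exists_freeGroupBasis_elim_zero exists_freeGroupBasis_elim_last exists_freeGroupBasis_cycleFirst
  exists_freeGroupBasis_cycleNode₂_values exists_freeGroupBasis_cycleNode₂_zero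
  exists_freeGroupBasis_cycleFirst_elim exists_freeGroupBasis_elim closure_cycleFirst_eq
  closure_cycleSecond_eq closure_cycleFirst_eq_elim closure_cycleSecond_eq_elim)
open SemiGraphOfAnabelioids (IsProSigmaCompletion infinite_cuspInertia_closure)
open SemiGraphOfAnabelioids.IsProSigmaCompletion (freeFactor_inf_conj_eq_bot_of_disjoint freeFactor_inf_eq
  infinite_freeFactor mem_freeFactor_of_inf_conj_ne_bot)

variable {P : Type} [Group P] [TopologicalSpace P] [IsTopologicalGroup P]
variable [CompactSpace P] [T2Space P] [TotallyDisconnectedSpace P] {Sigma : Set ℕ} {g r : ℕ}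

omit [TopologicalSpace P] [IsTopologicalGroup P] [CompactSpace P] [T2Space P]
  [TotallyDisconnectedSpace P] in
/-- An infinite subgroup is not trivial. [cite: MochizukiCombGC2007, Rmk 1.1.3 p.7] -/
private theorem ne_bot_of_infinite₇ {H : Subgroup P} (h : Infinite H) : H ≠ ⊥ := by
  rintro rfl
  exact h.not_finite inferInstance

omit [CompactSpace P] [TotallyDisconnectedSpace P] in
/-- The closure of the image of the trivial sub-basis is trivial. [cite: MochizukiCombGC2007, Rmk 1.1.3 p.7] -/
private theorem closure_map_closure_image_empty {Γ : Type*} [Group Γ] (ι : Γ →* P) {β : Type*} (bb : β → Γ) :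
    ((Subgroup.closure (bb '' (∅ : Set β))).map ι).topologicalClosure = ⊥ := by
  rw [Set.image_empty, Subgroup.closure_empty, Subgroup.map_bot]
  refine le_antisymm (Subgroup.topologicalClosure_minimal _ le_rfl ?_) bot_le
  rw [Subgroup.coe_bot]
  exact isClosed_singleton

/-- **F-0440 / [CombGC] Prop. 1.5 (i) at EVERY two-node-cycle datum with at least two cusps on each
component** (`m ≥ 1`, `g - m - 1 ≥ 1`, `2 ≤ s`, `s + 2 ≤ r`). [cite: MochizukiCombGC2007, Prop 1.5(i) p.12] -/
theorem edgeLikeIncidence_of_twoNodeCycle (hne : Sigma.Nonempty)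
    (hprime : ∀ p ∈ Sigma, p.Prime) (ι : PuncturedSurfaceGroup g r →* P)
    (hι : IsProSigmaCompletion Sigma ι) (G : PSCDatum P) {m s : ℕ} (hm : m + 2 ≤ g) (hm1 : 1 ≤ m)
    (hs2 : 2 ≤ s) (hsr : s + 2 ≤ r)
    (e : G.graph.C ≃ Fin r)
    (hC : ∀ c', G.cuspGp c' = ((cuspInertia (g := g) (e c')).map ι).topologicalClosure)
    (v₀ v₁ : G.graph.V) (hV : ∀ w, w = v₀ ∨ w = v₁)
    (n₁ n₂ : G.graph.N) (hN : ∀ n, n = n₁ ∨ n = n₂) (δ : PuncturedSurfaceGroup g r)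
    (hδ : δ = (((List.finRange r).map fun j : Fin r =>
        if (j : ℕ) < s then PuncturedSurfaceGroup.c (g := g) j else 1).prod)⁻¹ *
      (((List.finRange g).map fun i : Fin g => if m + 1 ≤ (i : ℕ) then
        PuncturedSurfaceGroup.a (r := r) i * PuncturedSurfaceGroup.b i *
          (PuncturedSurfaceGroup.a i)⁻¹ * (PuncturedSurfaceGroup.b i)⁻¹ else 1).prod)⁻¹ *
      PuncturedSurfaceGroup.b ⟨m, by omega⟩)
    (hV₀ : G.vertGp v₀ = ((Subgroup.closure {x : PuncturedSurfaceGroup g r |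
        (∃ i : Fin g, (i : ℕ) < m ∧ (x = PuncturedSurfaceGroup.a i ∨ x = PuncturedSurfaceGroup.b i)) ∨
        (∃ j : Fin r, s ≤ (j : ℕ) ∧ x = PuncturedSurfaceGroup.c j) ∨
        x = PuncturedSurfaceGroup.a ⟨m, by omega⟩ * PuncturedSurfaceGroup.b ⟨m, by omega⟩ *
          (PuncturedSurfaceGroup.a ⟨m, by omega⟩)⁻¹ ∨ x = δ}).map ι).topologicalClosure)
    (hV₁ : G.vertGp v₁ = ((Subgroup.closure {x : PuncturedSurfaceGroup g r |
        (∃ i : Fin g, m < (i : ℕ) ∧ (x = PuncturedSurfaceGroup.a i ∨ x = PuncturedSurfaceGroup.b i)) ∨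
        (∃ j : Fin r, (j : ℕ) < s ∧ x = PuncturedSurfaceGroup.c j) ∨
        x = PuncturedSurfaceGroup.b ⟨m, by omega⟩ ∨ x = δ}).map ι).topologicalClosure)
    (hE₁ : G.nodeGp n₁ = ((Subgroup.zpowers (PuncturedSurfaceGroup.b (r := r) ⟨m, by omega⟩)).map
      ι).topologicalClosure)
    (hE₂ : G.nodeGp n₂ = ((Subgroup.zpowers δ).map ι).topologicalClosure) :
    G.EdgeLikeIncidence := by
  classical
  obtain ⟨r', rfl⟩ : ∃ r', r = r' + 1 := ⟨r - 1, by omega⟩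
  have hmg : m < g := by omega
  have hsr' : s ≤ r' := by omega
  have hs1 : 1 ≤ s := by omega
  have hr0 : 0 < r' := by omega
  have hp : ∃ p ∈ Sigma, p.Prime := hne.imp fun p hp => ⟨hp, hprime p hp⟩
  have hhyp : PuncturedSurfaceGroup.IsHyperbolicType g (r' + 1) := by
    unfold PuncturedSurfaceGroup.IsHyperbolicType; omega
  set km : Fin g := ⟨m, hmg⟩ with hkm
  -- the bases
  obtain ⟨b₀, ha₀, hb₀, hc₀⟩ := exists_freeGroupBasis_elim_zero g r'
  obtain ⟨bA, haA, hbA, hkA, hcA⟩ := exists_freeGroupBasis_cycleFirst g r' m hmg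
  obtain ⟨bl, hal, hbl, hcl⟩ := exists_freeGroupBasis_elim_last g r'
  obtain ⟨bN, haN, hbN, hkN, hcN⟩ := exists_freeGroupBasis_cycleNode₂_values g r' m s hmg hsr' δ hδ
  obtain ⟨bZ, haZ, hbZ, hkZ, hcZ⟩ := exists_freeGroupBasis_cycleNode₂_zero g r' m s hmg hs1 δ hδ
  set S_A : Set ((Fin g × Bool) ⊕ Fin r') := {y | Sum.elim (fun p : Fin g × Bool =>
    (p.1 : ℕ) < m ∨ (p.1 = ⟨m, hmg⟩ ∧ p.2 = true)) (fun j : Fin r' => s ≤ (j : ℕ) + 1) y} with hS_A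
  set S_B : Set ((Fin g × Bool) ⊕ Fin r') := {y | Sum.elim (fun p : Fin g × Bool =>
    m < (p.1 : ℕ) ∨ (p.1 = ⟨m, hmg⟩ ∧ p.2 = true)) (fun j : Fin r' => (j : ℕ) < s) y} with hS_B
  have hV₀A : G.vertGp v₀ = ((Subgroup.closure (bA '' S_A)).map ι).topologicalClosure := by
    rw [hV₀, closure_cycleFirst_eq hmg hδ hs1 haA hbA hkA hcA]
  have hV₁B : G.vertGp v₁ = ((Subgroup.closure (bl '' S_B)).map ι).topologicalClosure := by
    rw [hV₁, closure_cycleSecond_eq hmg hδ hsr' hal hbl hcl]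
  -- generic tools
  have hle : ∀ (S : Set (PuncturedSurfaceGroup g (r' + 1))) (x : PuncturedSurfaceGroup g (r' + 1)), x ∈ S →
      ((Subgroup.zpowers x).map ι).topologicalClosure ≤ ((Subgroup.closure S).map ι).topologicalClosure :=
    fun S x hx => Subgroup.topologicalClosure_mono (Subgroup.map_mono ((Subgroup.zpowers_le).mpr
      (Subgroup.subset_closure hx)))
  have hdisj : ∀ (bb : FreeGroupBasis ((Fin g × Bool) ⊕ Fin r') (PuncturedSurfaceGroup g (r' + 1)))
      (p q : (Fin g × Bool) ⊕ Fin r'), p ≠ q → ∀ (x y : PuncturedSurfaceGroup g (r' + 1)), bb p = x → bb q = y →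
      ∀ z : P, ((Subgroup.zpowers x).map ι).topologicalClosure ⊓
        ConjAct.toConjAct z • ((Subgroup.zpowers y).map ι).topologicalClosure = ⊥ := by
    intro bb p q hpq x y hx hy z
    have h := freeFactor_inf_conj_eq_bot_of_disjoint bb {p} {q} (Set.disjoint_singleton.mpr hpq) hι z
    rwa [closure_image_singleton, closure_image_singleton, hx, hy] at h
  have hdisjS : ∀ (bb : FreeGroupBasis ((Fin g × Bool) ⊕ Fin r') (PuncturedSurfaceGroup g (r' + 1)))
      (p : (Fin g × Bool) ⊕ Fin r') (S : Set ((Fin g × Bool) ⊕ Fin r')), p ∉ S →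
      ∀ x : PuncturedSurfaceGroup g (r' + 1), bb p = x →
      ∀ z : P, ((Subgroup.zpowers x).map ι).topologicalClosure ⊓
        ConjAct.toConjAct z • ((Subgroup.closure (bb '' S)).map ι).topologicalClosure = ⊥ := by
    intro bb p S hpS x hx z
    have h := freeFactor_inf_conj_eq_bot_of_disjoint bb {p} S (Set.disjoint_singleton_left.mpr hpS) hι z
    rwa [closure_image_singleton, hx] at h
  have hzp : ∀ (bb : FreeGroupBasis ((Fin g × Bool) ⊕ Fin r') (PuncturedSurfaceGroup g (r' + 1)))
      (p : (Fin g × Bool) ⊕ Fin r') (x : PuncturedSurfaceGroup g (r' + 1)), bb p = x →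
      ((Subgroup.zpowers x).map ι).topologicalClosure =
        ((Subgroup.closure (bb '' {p})).map ι).topologicalClosure := fun bb p x hx => by
    rw [closure_image_singleton, hx]
  have hK : ∀ j : Fin (r' + 1), ((cuspInertia (g := g) j).map ι).topologicalClosure =
      ((Subgroup.zpowers (c (g := g) j)).map ι).topologicalClosure := fun _ => rfl
  -- an element of `Γ` mapping into the trivial closed subgroup while generating an infinite one: absurd
  have habs : ∀ (bb : FreeGroupBasis ((Fin g × Bool) ⊕ Fin r') (PuncturedSurfaceGroup g (r' + 1)))
      (p : (Fin g × Bool) ⊕ Fin r'), ι (bb p) = 1 → False := by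
    intro bb p h1
    have hinf := infinite_freeFactor bb {p} ⟨p, rfl⟩ hι hp
    apply ne_bot_of_infinite₇ hinf
    rw [closure_image_singleton, MonoidHom.map_zpowers, h1, Subgroup.zpowers_one_eq_bot]
    exact le_antisymm (Subgroup.topologicalClosure_minimal _ le_rfl (by
      rw [Subgroup.coe_bot]; exact isClosed_singleton)) bot_le
  refine G.edgeLikeIncidence_of_conj ?_ ?_ ?_ ?_ ?_ ?_
  · -- malnormality of the two vertex representatives
    intro v z hz
    rcases hV v with rfl | rfl
    · rw [hV₀A] at hz ⊢
      exact mem_freeFactor_of_inf_conj_ne_bot bA S_A hι hz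
    · rw [hV₁B] at hz ⊢
      exact mem_freeFactor_of_inf_conj_ne_bot bl S_B hι hz
  · -- node groups are infinite
    intro n
    rcases hN n with rfl | rfl
    · rw [hE₁, hzp b₀ (Sum.inl (km, true)) _ (hb₀ km)]
      exact ne_bot_of_infinite₇ (infinite_freeFactor b₀ {Sum.inl (km, true)} ⟨_, rfl⟩ hι hp)
    · have hkN' : bN (Sum.inl (km, true)) = δ := hkN
      have hinf : Infinite ((Subgroup.closure (bN '' {Sum.inl (km, true)})).map ι).topologicalClosure :=
        infinite_freeFactor bN {Sum.inl (km, true)} ⟨Sum.inl (km, true), rfl⟩ hι hp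
      rw [hE₂, hzp bN (Sum.inl (km, true)) δ hkN']
      exact ne_bot_of_infinite₇ hinf
  · -- cusp groups are infinite
    intro z
    rw [hC z]
    exact ne_bot_of_infinite₇ (infinite_cuspInertia_closure hne hprime hhyp ι hι (e z))
  · -- node groups meet no conjugate of a cusp group
    intro n z x
    rw [hC z, hK]
    set j := e z with hj
    rcases hN n with rfl | rfl
    · rw [hE₁]
      by_cases hj0 : j = 0
      · -- `b_m` and `c_0` are letters of `bl`
        refine hdisj bl (Sum.inl (km, true)) (Sum.inr ⟨0, hr0⟩) (by simp) _ _ (hbl km) ?_ x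
        rw [hcl, hj0]; rfl
      · -- `b_m` and `c_j` (`j ≥ 1`) are letters of `b₀`
        refine hdisj b₀ (Sum.inl (km, true)) (Sum.inr (j.pred hj0)) (by simp) _ _ (hb₀ km) ?_ x
        rw [hc₀, Fin.succ_pred]
    · rw [hE₂]
      by_cases hjr : (j : ℕ) < r'
      · -- `δ` and `c_j` (`j < r'`) are letters of `bN`
        refine hdisj bN (Sum.inl (⟨m, hmg⟩, true)) (Sum.inr ⟨j, hjr⟩) (by simp) _ _ hkN ?_ x
        rw [hcN]; congr 1
      · -- `δ` and `c_{r'}` are letters of `bZ`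
        have hjv : (j : ℕ) = r' := by have := j.2; omega
        refine hdisj bZ (Sum.inl (⟨m, hmg⟩, true)) (Sum.inr ⟨r' - 1, by omega⟩) (by simp) _ _ hkZ ?_ x
        rw [hcZ]; congr 1; ext; simp; omega
  · -- the two branches of each node, with conjugators, and the distinctness of the overgroups
    intro n
    rcases hN n with rfl | rfl
    · -- `n₁ = ⟨b_m⟩`: inside `Π_{v₁}` and inside `ι(a_m)⁻¹ Π_{v₀} ι(a_m)`
      refine ⟨v₁, v₀, 1, (ConjAct.toConjAct (ι (a km)))⁻¹, ?_, ?_, ?_, ?_⟩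
      · rw [one_smul, hE₁, hV₁]
        exact hle _ _ (Or.inr (Or.inr (Or.inl rfl)))
      · rw [← Subgroup.pointwise_smul_le_pointwise_smul_iff (a := ConjAct.toConjAct (ι (a km))), smul_inv_smul,
          hE₁, toConjAct_smul_topologicalClosure_map_zpowers, hV₀]
        exact hle _ _ (Or.inr (Or.inr (Or.inl rfl)))
      · -- distinctness: `a_0 ∈ Π_{v₀}`, but `a_m⁻¹ a_0 a_m ∉ Π_{v₁}`
        intro h
        rw [one_smul] at h
        have ha0V : ι (a (r := r' + 1) ⟨0, by omega⟩) ∈ G.vertGp v₀ := by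
          rw [hV₀]
          exact Subgroup.le_topologicalClosure _ (Subgroup.mem_map_of_mem ι
            (Subgroup.subset_closure (Or.inl ⟨⟨0, by omega⟩, by simp; omega, Or.inl rfl⟩)))
        have hw : ι ((a km)⁻¹ * a (r := r' + 1) ⟨0, by omega⟩ * a km) ∈ G.vertGp v₁ := by
          have h2 : (ConjAct.toConjAct (ι (a km)))⁻¹ • ι (a (r := r' + 1) ⟨0, by omega⟩) ∈
              (ConjAct.toConjAct (ι (a km)))⁻¹ • G.vertGp v₀ := Subgroup.smul_mem_pointwise_smul _ _ _ ha0V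
          rw [← h, ← map_inv, ConjAct.toConjAct_smul] at h2
          simpa only [map_mul, map_inv, inv_inv] using h2
        -- the word `a_m⁻¹ a_0 a_m` lies in the sub-basis `{a_m, a_0}` of `bl`, disjoint from `S_B`
        set T : Set ((Fin g × Bool) ⊕ Fin r') := {Sum.inl (km, false), Sum.inl (⟨0, by omega⟩, false)} with hT
        have hwT : (a km)⁻¹ * a (r := r' + 1) ⟨0, by omega⟩ * a km ∈ Subgroup.closure (bl '' T) := by
          have h1 : a (r := r' + 1) km ∈ Subgroup.closure (bl '' T) :=
            Subgroup.subset_closure ⟨Sum.inl (km, false), by simp [hT], hal km⟩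
          have h0 : a (r := r' + 1) ⟨0, by omega⟩ ∈ Subgroup.closure (bl '' T) :=
            Subgroup.subset_closure ⟨Sum.inl (⟨0, by omega⟩, false), by simp [hT], hal _⟩
          exact Subgroup.mul_mem _ (Subgroup.mul_mem _ (Subgroup.inv_mem _ h1) h0) h1
        have hST : S_B ∩ T = ∅ := by
          ext y
          simp only [Set.mem_inter_iff, Set.mem_empty_iff_false, iff_false, not_and, hT, Set.mem_insert_iff,
            Set.mem_singleton_iff]
          rintro hy (rfl | rfl)
          · rcases hy with hy | ⟨-, hy⟩
            · exact absurd hy (by simp [km])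
            · exact absurd hy (by simp)
          · rcases hy with hy | ⟨hy, -⟩
            · exact absurd hy (by simp)
            · exact absurd hy (fun h' => by have := congrArg Fin.val h'; simp at this; omega)
        have hmem : ι ((a km)⁻¹ * a (r := r' + 1) ⟨0, by omega⟩ * a km) ∈
            ((Subgroup.closure (bl '' S_B)).map ι).topologicalClosure ⊓
              ((Subgroup.closure (bl '' T)).map ι).topologicalClosure :=
          ⟨hV₁B ▸ hw, Subgroup.le_topologicalClosure _ (Subgroup.mem_map_of_mem ι hwT)⟩
        rw [freeFactor_inf_eq bl S_B T hι, hST, closure_map_closure_image_empty, Subgroup.mem_bot, map_mul,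
          map_mul, map_inv] at hmem
        have h1 : ι (a (r := r' + 1) ⟨0, by omega⟩) = 1 := by
          have := congrArg (fun t => ι (a km) * t * (ι (a km))⁻¹) hmem
          simpa only [mul_one, mul_inv_cancel, ← mul_assoc, mul_inv_cancel_left, one_mul, mul_inv_cancel_right]
            using this
        exact habs bl (Sum.inl (⟨0, by omega⟩, false)) (by rw [hal]; exact h1)
      · intro w hw₁ hw₀
        rcases hV w with rfl | rfl
        · exact absurd rfl hw₀
        · exact absurd rfl hw₁
    · -- `n₂ = ⟨δ⟩`: inside both representatives
      refine ⟨v₀, v₁, 1, 1, ?_, ?_, ?_, ?_⟩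
      · rw [one_smul, hE₂, hV₀]
        exact hle _ _ (Or.inr (Or.inr (Or.inr rfl)))
      · rw [one_smul, hE₂, hV₁]
        exact hle _ _ (Or.inr (Or.inr (Or.inr rfl)))
      · -- distinctness: `b_{m+1} ∈ Π_{v₁} \ Π_{v₀}`
        intro h
        rw [one_smul, one_smul] at h
        have hb1 : ι (PuncturedSurfaceGroup.b (r := r' + 1) ⟨m + 1, by omega⟩) ∈ G.vertGp v₁ := by
          rw [hV₁]
          exact Subgroup.le_topologicalClosure _ (Subgroup.mem_map_of_mem ι
            (Subgroup.subset_closure (Or.inl ⟨⟨m + 1, by omega⟩, by simp, Or.inr rfl⟩)))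
        set T : Set ((Fin g × Bool) ⊕ Fin r') := {Sum.inl (⟨m + 1, by omega⟩, true)} with hT
        have hbT : PuncturedSurfaceGroup.b (r := r' + 1) ⟨m + 1, by omega⟩ ∈ Subgroup.closure (bA '' T) :=
          Subgroup.subset_closure ⟨Sum.inl (⟨m + 1, by omega⟩, true), by simp [hT],
            hbA _ (fun h' => by have := congrArg Fin.val h'; simp at this)⟩
        have hST : S_A ∩ T = ∅ := by
          ext y
          simp only [Set.mem_inter_iff, Set.mem_empty_iff_false, iff_false, not_and, hT, Set.mem_singleton_iff]
          rintro hy rfl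
          rcases hy with hy | ⟨hy, -⟩
          · exact absurd hy (by simp)
          · exact absurd hy (fun h' => by have := congrArg Fin.val h'; simp at this)
        have hmem : ι (PuncturedSurfaceGroup.b (r := r' + 1) ⟨m + 1, by omega⟩) ∈
            ((Subgroup.closure (bA '' S_A)).map ι).topologicalClosure ⊓
              ((Subgroup.closure (bA '' T)).map ι).topologicalClosure :=
          ⟨hV₀A ▸ h ▸ hb1, Subgroup.le_topologicalClosure _ (Subgroup.mem_map_of_mem ι hbT)⟩
        rw [freeFactor_inf_eq bA S_A T hι, hST, closure_map_closure_image_empty, Subgroup.mem_bot] at hmem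
        exact habs bA (Sum.inl (⟨m + 1, by omega⟩, true))
          (by rw [hbA _ (fun h' => by have := congrArg Fin.val h'; simp at this)]; exact hmem)
      · intro w hw₀ hw₁
        rcases hV w with rfl | rfl
        · exact absurd rfl hw₀
        · exact absurd rfl hw₁
  · -- each cusp: inside its vertex, disjoint from every conjugate of the other vertex
    intro z
    set j := e z with hj
    by_cases hjs : (j : ℕ) < s
    · -- a cusp of `v₁`
      refine ⟨v₁, 1, ?_, ?_⟩
      · rw [one_smul, hC z, hK, hV₁]
        exact hle _ _ (Or.inr (Or.inl ⟨j, hjs, rfl⟩))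
      · intro w hw x
        obtain rfl : w = v₀ := (hV w).resolve_right hw
        -- eliminate ANOTHER cusp `c_t` of `v₁` (`t ∈ {0, 1} ∖ {j}`, `t < s`)
        obtain ⟨t, hts, hjt⟩ : ∃ t : Fin (r' + 1), (t : ℕ) < s ∧ j ≠ t := by
          by_cases hj0 : (j : ℕ) = 0
          · exact ⟨⟨1, by omega⟩, by simp only; omega, fun h => by rw [h] at hj0; simp at hj0⟩
          · exact ⟨⟨0, by omega⟩, by simp only; omega, fun h => hj0 (by rw [h])⟩
        obtain ⟨bt, hat, hbt, hkt, hct⟩ := exists_freeGroupBasis_cycleFirst_elim g r' m hmg t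
        obtain ⟨zj, hzj⟩ := Fin.exists_succAbove_eq hjt
        rw [hC z, hK, hV₀, closure_cycleFirst_eq_elim hmg hδ t hts hat hbt hkt hct]
        refine hdisjS bt (Sum.inr zj) _ ?_ _ (by rw [hct, hzj]) x
        change ¬ (s ≤ ((t.succAbove zj : Fin (r' + 1)) : ℕ))
        rw [hzj]; omega
    · -- a cusp of `v₀`
      refine ⟨v₀, 1, ?_, ?_⟩
      · rw [one_smul, hC z, hK, hV₀]
        exact hle _ _ (Or.inr (Or.inl ⟨j, not_lt.mp hjs, rfl⟩))
      · intro w hw x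
        obtain rfl : w = v₁ := (hV w).resolve_left hw
        -- eliminate ANOTHER cusp `c_t` of `v₀` (`t ∈ {s, s+1} ∖ {j}`, `s ≤ t`)
        obtain ⟨t, hts, hjt⟩ : ∃ t : Fin (r' + 1), s ≤ (t : ℕ) ∧ j ≠ t := by
          by_cases hjs' : (j : ℕ) = s
          · exact ⟨⟨s + 1, by omega⟩, by simp only; omega, fun h => by rw [h] at hjs'; simp at hjs'⟩
          · exact ⟨⟨s, by omega⟩, by simp only; omega, fun h => hjs' (by rw [h])⟩
        obtain ⟨bu, hau, hbu, hcu⟩ := exists_freeGroupBasis_elim g r' t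
        obtain ⟨zj, hzj⟩ := Fin.exists_succAbove_eq hjt
        rw [hC z, hK, hV₁, closure_cycleSecond_eq_elim hmg hδ t hts hau hbu hcu]
        refine hdisjS bu (Sum.inr zj) _ ?_ _ (by rw [hcu, hzj]) x
        change ¬ (((t.succAbove zj : Fin (r' + 1)) : ℕ) < s)
        rw [hzj]; omega

end PSCDatum

end Literature.AnabelianGeometry.SemiGraphs

end
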